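import Mathlib
import HarnessLib
import Summits.ValiantsHypothesis.ValiantsHypothesis.Theorems.LacunarySymmetroidMatrixDescartesProductPlusOneSlopeLine

/-!
# LINE (A) `product_plus_one` — the three phases of a switched incoherent riser's slope (negative phase increasing, one slope-mode,
# mode / pre-mode persistence); the monotone-window cells built on them live in `…ProductPlusOneSlopePhasesLine`

Crux item stmt-ValiantsHypothesis-18050, W-budget frame EB2-W (`WronskianBudgetK3`, owner memo §14/§19; eng-11 W-COLUMN §5 «c₀ + K(I)»).
Notation of ✓ `…CloudDefs`: row `A − Bx^p − Cx^q` (`p = e₁+1`, `q = e₁+e₂+2`), `u = rowU = 1/(A − Bx^p − Cx^q)`, `H_k = rowH k`,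
`ψ₁ = rowPsi1 = H₂u + H₁²u²` (so the row's slope is `s = θφ = −ψ₁`, ✓ `logWronskian_row_eq_rowPsi1`), `ψ₂ = rowPsi2 = θψ₁`, `ψ₃ = rowPsi3`.

§1 (one row, pointwise / along a switched stretch):
* `switched_rowPsi2_neg_of_rowPsi1_nonneg` — NEGATIVE PHASE ⇒ SLOPE INCREASING: a switched incoherent row (`A − Bx^p − Cx^q < 0`, `B, C > 0`)
  at or before its turning point (`ψ₁ ≥ 0`, i.e. `s ≤ 0`) has `ψ₂ < 0` (`θs > 0`).  Certificate: `H₁ψ₂ = u·(H₁H₃ − H₂²) + u·E·(2E − H₂)` with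
  `E = H₂ + H₁²u ≤ 0` (✓ `rowH1_mul_rowPsi2`, ✓ `rowH_det13`).  So the Euler ratio `φ` of a switched incoherent row is CONVEX in `log x` from its pole
  to its turning point; with ✓ `riser_slope_logConcave` (rising phase) the slope `s` increases from `−∞` at the pole to ONE maximum (the slope-mode)
  and then decreases: three phases, one mode.
* `riser_mode_persist` — past the mode stays past the mode: switched on `[x₁,x₂]`, `ψ₁(x₁) < 0`, `ψ₂(x₁) ≥ 0` ⇒ `ψ₂ > 0` on `(x₁,x₂]`
  (`ψ₂/ψ₁` is strictly decreasing where `ψ₁ < 0`).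
* `riser_premode_persist` — before the mode was before the mode: switched on `[x₁,x₂]`, `ψ₂(x₂) ≤ 0` ⇒ `ψ₂ < 0` on `[x₁,x₂)`.

§2 `exists_two_lt_of_card` (a finite set of reals with two elements has `y₁ < y₂`; used by the window counts of `…SlopePhasesLine`).

Located context (this seat's numerics, bus 05:02Z): two risers + cloud carries ≤ 4 zeros per window and the feature-free window (young row in its
negative phase + old humps + pullers) ≤ 2, both 0 violations under adversarial search — NOT proved here (no sign/convexity mechanism; magnitude law).
HONEST FRAMING: structure lemmas about ONE row; nothing here proves `WronskianBudgetK3` / `OneChangeFloorK3` / the stubs / 18050 /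
`MatrixDescartes`; `VP ≠ VNP` is NOT proved.  No definitions, no named facts.
-/

set_option linter.dupNamespace false

namespace Summit.ValiantsHypothesis.ValiantsHypothesis.Theorems.LacunarySymmetroidMatrixDescartes

namespace ProductPlusOne

open Finset Polynomial
open scoped BigOperators Polynomial

/-! ### §1 The phases of one switched incoherent row -/

section Row

variable (e₁ e₂ : ℕ) (A B C : ℝ)

/-- **Negative phase ⇒ slope increasing.**  Switched incoherent row (`A − Bx^p − Cx^q < 0`, `B, C > 0`, `x > 0`) at or before its turning point
(`0 ≤ ψ₁`): `ψ₂ < 0`. [this file's lemma] -/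
theorem switched_rowPsi2_neg_of_rowPsi1_nonneg {x : ℝ} (hx : 0 < x) (hB : 0 < B) (hC : 0 < C)
    (hF : A - B * x ^ (e₁ + 1) - C * x ^ (e₁ + e₂ + 2) < 0) (hpre : 0 ≤ rowPsi1 e₁ e₂ A B C x) :
    rowPsi2 e₁ e₂ A B C x < 0 := by
  have hu : rowU e₁ e₂ A B C x < 0 := by unfold rowU; exact inv_lt_zero.2 hF
  set u := rowU e₁ e₂ A B C x with hudef
  set E := rowH e₁ e₂ 2 B C x + rowH e₁ e₂ 1 B C x ^ 2 * u with hE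
  have hH1 : 0 < rowH e₁ e₂ 1 B C x := rowH_one_pos e₁ e₂ B C hx hB.le hC.le (by linarith)
  have hH2 : 0 ≤ rowH e₁ e₂ 2 B C x := rowH_nonneg e₁ e₂ B C 2 hx hB.le hC.le
  -- `ψ₁ = u·E ≥ 0` with `u < 0` forces `E ≤ 0`
  have hE_nonpos : E ≤ 0 := by
    have h1 : rowPsi1 e₁ e₂ A B C x = u * E := rowPsi1_eq_mul e₁ e₂ A B C x
    rw [h1] at hpre
    by_contra hlt
    push Not at hlt
    have : u * E < 0 := mul_neg_of_neg_of_pos hu hlt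
    linarith
  have hdet : 0 < rowH e₁ e₂ 1 B C x * rowH e₁ e₂ 3 B C x - rowH e₁ e₂ 2 B C x ^ 2 := by
    rw [rowH_det13]
    have hβ : 0 < B * x ^ (e₁ + 1) := by positivity
    have hγ : 0 < C * x ^ (e₁ + e₂ + 2) := by positivity
    positivity
  have hkey := rowH1_mul_rowPsi2 e₁ e₂ A B C x
  -- `H₁ψ₂ = u·det + u·E·(2E − H₂)` and both summands are `≤ 0`, the first `< 0`
  have h2E : rowH e₁ e₂ 2 B C x + 2 * rowH e₁ e₂ 1 B C x ^ 2 * u = 2 * E - rowH e₁ e₂ 2 B C x := by rw [hE]; ring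
  have hprod : 0 ≤ E * (rowH e₁ e₂ 2 B C x + 2 * rowH e₁ e₂ 1 B C x ^ 2 * u) := by
    rw [h2E]; exact mul_nonneg_of_nonpos_of_nonpos hE_nonpos (by linarith)
  have hlt : rowH e₁ e₂ 1 B C x * rowPsi2 e₁ e₂ A B C x < 0 := by
    rw [hkey]
    have t1 : u * (rowH e₁ e₂ 1 B C x * rowH e₁ e₂ 3 B C x - rowH e₁ e₂ 2 B C x ^ 2) < 0 := mul_neg_of_neg_of_pos hu hdet
    have t2 : u * (rowH e₁ e₂ 2 B C x + rowH e₁ e₂ 1 B C x ^ 2 * u) * (rowH e₁ e₂ 2 B C x + 2 * rowH e₁ e₂ 1 B C x ^ 2 * u) ≤ 0 := by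
      rw [← hE, mul_assoc]; exact mul_nonpos_of_nonpos_of_nonneg hu.le hprod
    linarith
  by_contra hge
  push Not at hge
  have : 0 ≤ rowH e₁ e₂ 1 B C x * rowPsi2 e₁ e₂ A B C x := mul_nonneg hH1.le hge
  linarith

/-- The derivative of `ψ₂/ψ₁` along a switched stretch where `ψ₁ < 0`: strictly negative (✓ `riser_slope_logConcave`). [this file's lemma] -/
theorem hasDerivAt_rowPsi2_div_rowPsi1 (hA : 0 ≤ A) (hB : 0 < B) (hC : 0 < C) {x : ℝ} (hx : 0 < x)
    (hF : A - B * x ^ (e₁ + 1) - C * x ^ (e₁ + e₂ + 2) < 0) (hpost : rowPsi1 e₁ e₂ A B C x < 0) :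
    ∃ D : ℝ, D < 0 ∧ HasDerivAt (fun t => rowPsi2 e₁ e₂ A B C t / rowPsi1 e₁ e₂ A B C t) D x := by
  have d1 := hasDerivAt_rowPsi1 e₁ e₂ A B C hx.ne' hF.ne
  have d2 := hasDerivAt_rowPsi2 e₁ e₂ A B C hx.ne' hF.ne
  have hquot := d2.div d1 hpost.ne
  have hlc := riser_slope_logConcave e₁ e₂ A B C hx hA hB.le hC.le hF hpost
  refine ⟨(rowPsi3 e₁ e₂ A B C x * rowPsi1 e₁ e₂ A B C x - rowPsi2 e₁ e₂ A B C x ^ 2) / (x * rowPsi1 e₁ e₂ A B C x ^ 2), ?_, ?_⟩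
  · exact div_neg_of_neg_of_pos (by linarith) (mul_pos hx (sq_pos_iff.mpr hpost.ne))
  · refine hquot.congr_deriv ?_
    have hψ1ne : rowPsi1 e₁ e₂ A B C x ≠ 0 := hpost.ne
    have hxne : x ≠ 0 := hx.ne'
    field_simp

/-- ★ **Mode persistence.**  Riser `A − Bx^p − Cx^q` (`A ≥ 0`, `B, C > 0`) switched on `[x₁, x₂] ⊂ (0,∞)`, past its turning point at `x₁`
(`ψ₁(x₁) < 0`) and at or past its slope-mode there (`ψ₂(x₁) ≥ 0`, i.e. `θs ≤ 0`): then `ψ₂ > 0` on `(x₁, x₂]` — the slope keeps decreasing. [this file's theorem] -/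
theorem riser_mode_persist (hA : 0 ≤ A) (hB : 0 < B) (hC : 0 < C) {x₁ x₂ : ℝ} (h0 : 0 < x₁) (h12 : x₁ ≤ x₂)
    (hsw : ∀ x ∈ Set.Icc x₁ x₂, A - B * x ^ (e₁ + 1) - C * x ^ (e₁ + e₂ + 2) < 0)
    (hpost : rowPsi1 e₁ e₂ A B C x₁ < 0) (hmode : 0 ≤ rowPsi2 e₁ e₂ A B C x₁) :
    ∀ x ∈ Set.Ioc x₁ x₂, 0 < rowPsi2 e₁ e₂ A B C x := by
  have hx0 : ∀ x ∈ Set.Icc x₁ x₂, 0 < x := fun x hx => h0.trans_le hx.1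
  -- `ψ₁ < 0` on the whole stretch
  have hneg : ∀ x ∈ Set.Icc x₁ x₂, rowPsi1 e₁ e₂ A B C x < 0 := by
    intro x hx
    rcases eq_or_lt_of_le hx.1 with h | h
    · rw [← h]; exact hpost
    · exact riser_turning_persist e₁ e₂ A B C hB hC h0 h12 hsw hpost.le x ⟨h, hx.2⟩
  -- `g = ψ₂/ψ₁` strictly decreasing
  set g : ℝ → ℝ := fun t => rowPsi2 e₁ e₂ A B C t / rowPsi1 e₁ e₂ A B C t with hg
  have hder : ∀ x ∈ Set.Icc x₁ x₂, ∃ D : ℝ, D < 0 ∧ HasDerivAt g D x := fun x hx =>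
    hasDerivAt_rowPsi2_div_rowPsi1 e₁ e₂ A B C hA hB hC (hx0 x hx) (hsw x hx) (hneg x hx)
  have hcont : ContinuousOn g (Set.Icc x₁ x₂) := fun x hx => by
    obtain ⟨D, _, hD⟩ := hder x hx; exact hD.continuousAt.continuousWithinAt
  have hanti : StrictAntiOn g (Set.Icc x₁ x₂) := by
    refine strictAntiOn_of_deriv_neg (convex_Icc x₁ x₂) hcont fun x hx => ?_
    rw [interior_Icc] at hx
    obtain ⟨D, hDneg, hD⟩ := hder x ⟨hx.1.le, hx.2.le⟩
    rw [hD.deriv]; exact hDneg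
  have hg1 : g x₁ ≤ 0 := by
    simp only [hg]; exact div_nonpos_of_nonneg_of_nonpos hmode hpost.le
  intro x hx
  have hx' : x ∈ Set.Icc x₁ x₂ := ⟨hx.1.le, hx.2⟩
  have hgx : g x < 0 := lt_of_lt_of_le (hanti ⟨le_rfl, h12⟩ hx' hx.1) hg1
  simp only [hg] at hgx
  have hψ1 := hneg x hx'
  by_contra hle
  push Not at hle
  have : 0 ≤ rowPsi2 e₁ e₂ A B C x / rowPsi1 e₁ e₂ A B C x := div_nonneg_of_nonpos hle hψ1.le
  linarith

/-- ★ **Pre-mode persistence.**  Riser (`A ≥ 0`, `B, C > 0`) switched on `[x₁, x₂] ⊂ (0,∞)` and at or before its slope-mode at `x₂`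
(`ψ₂(x₂) ≤ 0`): then `ψ₂ < 0` on `[x₁, x₂)` — the slope was increasing all along (negative phase by `switched_rowPsi2_neg_of_rowPsi1_nonneg`,
rising phase by the strict decrease of `ψ₂/ψ₁`). [this file's theorem] -/
theorem riser_premode_persist (hA : 0 ≤ A) (hB : 0 < B) (hC : 0 < C) {x₁ x₂ : ℝ} (h0 : 0 < x₁)
    (hsw : ∀ x ∈ Set.Icc x₁ x₂, A - B * x ^ (e₁ + 1) - C * x ^ (e₁ + e₂ + 2) < 0)
    (hmode : rowPsi2 e₁ e₂ A B C x₂ ≤ 0) :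
    ∀ x ∈ Set.Ico x₁ x₂, rowPsi2 e₁ e₂ A B C x < 0 := by
  intro x hx
  have hxI : x ∈ Set.Icc x₁ x₂ := ⟨hx.1, hx.2.le⟩
  have hx0 : 0 < x := h0.trans_le hx.1
  rcases le_or_gt 0 (rowPsi1 e₁ e₂ A B C x) with hpre | hpost
  · exact switched_rowPsi2_neg_of_rowPsi1_nonneg e₁ e₂ A B C hx0 hB hC (hsw x hxI) hpre
  · -- rising at `x`: then rising on `[x, x₂]`, and `ψ₂/ψ₁` decreases strictly from `x` to `x₂`
    have hsw' : ∀ t ∈ Set.Icc x x₂, A - B * t ^ (e₁ + 1) - C * t ^ (e₁ + e₂ + 2) < 0 :=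
      fun t ht => hsw t ⟨hx.1.trans ht.1, ht.2⟩
    have hneg : ∀ t ∈ Set.Icc x x₂, rowPsi1 e₁ e₂ A B C t < 0 := by
      intro t ht
      rcases eq_or_lt_of_le ht.1 with h | h
      · rw [← h]; exact hpost
      · exact riser_turning_persist e₁ e₂ A B C hB hC hx0 hx.2.le hsw' hpost.le t ⟨h, ht.2⟩
    set g : ℝ → ℝ := fun t => rowPsi2 e₁ e₂ A B C t / rowPsi1 e₁ e₂ A B C t with hg
    have hder : ∀ t ∈ Set.Icc x x₂, ∃ D : ℝ, D < 0 ∧ HasDerivAt g D t := fun t ht =>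
      hasDerivAt_rowPsi2_div_rowPsi1 e₁ e₂ A B C hA hB hC (hx0.trans_le ht.1) (hsw' t ht) (hneg t ht)
    have hcont : ContinuousOn g (Set.Icc x x₂) := fun t ht => by
      obtain ⟨D, _, hD⟩ := hder t ht; exact hD.continuousAt.continuousWithinAt
    have hanti : StrictAntiOn g (Set.Icc x x₂) := by
      refine strictAntiOn_of_deriv_neg (convex_Icc x x₂) hcont fun t ht => ?_
      rw [interior_Icc] at ht
      obtain ⟨D, hDneg, hD⟩ := hder t ⟨ht.1.le, ht.2.le⟩
      rw [hD.deriv]; exact hDneg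
    have hψ1x2 := hneg x₂ ⟨hx.2.le, le_rfl⟩
    have hg2 : 0 ≤ g x₂ := by simp only [hg]; exact div_nonneg_of_nonpos hmode hψ1x2.le
    have hgx : 0 < g x := lt_of_le_of_lt hg2 (hanti ⟨le_rfl, hx.2.le⟩ ⟨hx.2.le, le_rfl⟩ hx.2)
    simp only [hg] at hgx
    by_contra hge
    push Not at hge
    have : rowPsi2 e₁ e₂ A B C x / rowPsi1 e₁ e₂ A B C x ≤ 0 := div_nonpos_of_nonneg_of_nonpos hge hpost.le
    linarith

end Row

/-! ### §2 A two-element finite set of reals -/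

/-- A finite set of reals with at least two elements contains `y₁ < y₂`. [folklore] -/
theorem exists_two_lt_of_card {T : Finset ℝ} (h : 2 ≤ T.card) : ∃ y₁ ∈ T, ∃ y₂ ∈ T, y₁ < y₂ := by
  have hT : T.Nonempty := Finset.card_pos.1 (by omega)
  set y₁ := T.min' hT with hy₁
  have hT2 : (T.erase y₁).Nonempty := Finset.card_pos.1 (by rw [Finset.card_erase_of_mem (T.min'_mem hT)]; omega)
  obtain ⟨y₂, hy₂⟩ := hT2
  refine ⟨y₁, T.min'_mem hT, y₂, Finset.mem_of_mem_erase hy₂, ?_⟩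
  exact lt_of_le_of_ne (T.min'_le _ (Finset.mem_of_mem_erase hy₂)) (Finset.ne_of_mem_erase hy₂).symm

end ProductPlusOne

end Summit.ValiantsHypothesis.ValiantsHypothesis.Theorems.LacunarySymmetroidMatrixDescartes
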